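import Mathlib
import HarnessLib
import Summits.HubbardSuperconductivity.HubbardSuperconductivity.Theorems.KLProgrammeC4aBubblePartition

/-!
# Route `KLProgramme` — crux C4a, S3 brick (B3, PARTITION, ph twin): translation `p ↦ p + D` on the zone box, the three-piece tube/far partition
# of the co-moving ph (crossed) bubble, and its far-far piece differentiated under the zone integral at every order

Cell `gate-hubbard-kl`, seat hubbard-kl-k3c3-p3 (g24; row «implicit-function / monotonicity route»).  ph twin of `…C4aBubblePartition` (part 2 of the
located brick «(B3)-ALL-ORDERS», stub (C) `stub_twoLeg_curvature` of `KLRegimeEngineV17F2`, stmt-HubbardSuperconductivity-20437; C4A-PLAN §24.8 (iii)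
«the ph loop has the same two configurations … all statements exist in both flavours», §24.9 (i)/(iv)).  The crossed bubble read at the transfer
momentum `D` is `B_ph(D) = ∫_{(−π,π)²} Ψ₁(e_K q̂)·Ψ₂(e_K(q̂ − D)) dq`; the partner-on-the-tube piece is read with the partner as the tube variable after
the TRANSLATION `q ↦ q + D` (instead of the reflection `q ↦ R − q` of the pp class):

* §1 `setIntegral_zoneBox_comp_neg` (`∫ F(−p) = ∫ F(p)`), **`setIntegral_zoneBox_comp_add`** (`∫ F(p + D) dp = ∫ F(p) dp` for continuous
  coordinate-periodic `F`), **`zoneBox_translate`** (`∫ Φ₁(q̂)·Φ₂(q̂ − D) = ∫ Φ₂(q̂)·Φ₁(q̂ + D)` on the momentum plane);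
* §2 **`zoneBox_bubble_ph_eq_three_pieces`** (+ the `[−π,π)²` form) — `B_ph(D) = ∫(χΨ₁)(e_K q̂)·Ψ₂(e_K(q̂−D)) + ∫(χΨ₂)(e_K q̂)·((1−χ)Ψ₁)(e_K(q̂+D)) + FF`;
* §3 the far-far piece at the co-moving transfer momentum `D(θ) = Φ(0,θ) − Φ(ρ′,ϑ′+θ)`: `contDiff_farIntegrand_ph`, **`iteratedDeriv_farIntegral_ph_eq`**,
  `contDiff_farIntegral_ph`, `norm_iteratedDeriv_farIntegral_ph_le` (every order; counting by `norm_iteratedDeriv_scomp_le_factorial_one`).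

Measure-theoretic bookkeeping on landed objects; nothing about the model's sizes; nothing asserts superconductivity.  References: FST II CPAM 51 (1998) §3;
BGM 2006 §2.4 (2.40) [cite: BenfattoGiulianiMastropietro2006].
-/

noncomputable section

namespace Summit.HubbardSuperconductivity.HubbardSuperconductivity.Theorems.C4a

set_option linter.dupNamespace false -- summit = problem name (single-conjunct summit), D-0017

open Real Set Filter MeasureTheory Metric
open scoped Topology ContDiff
open Literature.MathematicalPhysics.QuantumLattice Literature.MathematicalPhysics.QuantumLattice.BandSectorCounting Literature.Probability.LatticeModels
open Summit.HubbardSuperconductivity.HubbardSuperconductivity.Theorems.KLRegimeSplit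
open Summit.HubbardSuperconductivity.HubbardSuperconductivity.Theorems.DispersionFlow
open Summit.HubbardSuperconductivity.HubbardSuperconductivity.Theorems.PerturbedFermiCurve

/-! ## §1 Reflection and translation on the zone box -/

section Translate

variable {E' : Type*} [NormedAddCommGroup E'] [NormedSpace ℝ E']

/-- Reflection: `∫_{(−π,π)²} F(−p) dp = ∫_{(−π,π)²} F(p) dp` for continuous coordinate-periodic `F` (the swap at `S = 0`). [folklore] -/
theorem setIntegral_zoneBox_comp_neg {F : ℝ × ℝ → E'} (hF : Continuous F)
    (h1 : ∀ x y, F (x + 2 * π, y) = F (x, y)) (h2 : ∀ x y, F (x, y + 2 * π) = F (x, y)) :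
    ∫ p in Ioo (-π) π ×ˢ Ioo (-π) π, F (-p) = ∫ p in Ioo (-π) π ×ˢ Ioo (-π) π, F p := by
  have h := setIntegral_zoneBox_comp_sub hF h1 h2 0
  simpa only [zero_sub] using h

/-- **TRANSLATION ON THE ZONE BOX**: `∫_{(−π,π)²} F(p + D) dp = ∫_{(−π,π)²} F(p) dp` for continuous coordinate-periodic `F` and any `D`
(reflection ∘ swap). [folklore] -/
theorem setIntegral_zoneBox_comp_add {F : ℝ × ℝ → E'} (hF : Continuous F)
    (h1 : ∀ x y, F (x + 2 * π, y) = F (x, y)) (h2 : ∀ x y, F (x, y + 2 * π) = F (x, y)) (D : ℝ × ℝ) :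
    ∫ p in Ioo (-π) π ×ˢ Ioo (-π) π, F (p + D) = ∫ p in Ioo (-π) π ×ˢ Ioo (-π) π, F p := by
  -- `G(p) := F(−p)` is continuous and coordinate-periodic, and `F(p + D) = G((−D) − p)`
  set G : ℝ × ℝ → E' := fun p => F (-p) with hG
  have hGc : Continuous G := hF.comp continuous_neg
  have hG1 : ∀ x y, G (x + 2 * π, y) = G (x, y) := fun x y => by
    simp only [hG, Prod.neg_mk, neg_add]
    have h := h1 (-x - 2 * π) (-y)
    rw [show -x - 2 * π + 2 * π = -x by ring] at h
    rw [← sub_eq_add_neg, h]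
  have hG2 : ∀ x y, G (x, y + 2 * π) = G (x, y) := fun x y => by
    simp only [hG, Prod.neg_mk, neg_add]
    have h := h2 (-x) (-y - 2 * π)
    rw [show -y - 2 * π + 2 * π = -y by ring] at h
    rw [← sub_eq_add_neg, h]
  have hswap := setIntegral_zoneBox_comp_sub hGc hG1 hG2 (-D)
  have hrefl := setIntegral_zoneBox_comp_neg hF h1 h2
  have hfun : ∀ p : ℝ × ℝ, G (-D - p) = F (p + D) := fun p => by
    simp only [hG]; congr 1; abel
  simp only [hfun] at hswap
  rw [hswap]
  exact hrefl

/-- Coordinates of a sum: `toLp ![a + c, b + d] = toLp ![a, b] + toLp ![c, d]`. -/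
theorem toLp_pair_add (a b c d : ℝ) :
    (WithLp.toLp 2 ![a + c, b + d] : Momentum) = WithLp.toLp 2 ![a, b] + WithLp.toLp 2 ![c, d] := by
  rw [← WithLp.toLp_add]
  congr 1
  funext i
  fin_cases i <;> simp

/-- **TRANSLATION FOR A PRODUCT ON THE MOMENTUM PLANE**: for continuous `Φ₁, Φ₂ : Momentum → ℂ`, `2π`-periodic in each coordinate, and any `D`,
`∫_{(−π,π)²} Φ₁(q̂)·Φ₂(q̂ − D) dq = ∫_{(−π,π)²} Φ₂(q̂)·Φ₁(q̂ + D) dq`. -/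
theorem zoneBox_translate {Φ₁ Φ₂ : Momentum → ℂ} (hΦ₁ : Continuous Φ₁) (hΦ₂ : Continuous Φ₂)
    (hp₁ : ∀ (j : Fin 2) (q : Momentum), Φ₁ (q + EuclideanSpace.single j (2 * π)) = Φ₁ q)
    (hp₂ : ∀ (j : Fin 2) (q : Momentum), Φ₂ (q + EuclideanSpace.single j (2 * π)) = Φ₂ q) (D : Momentum) :
    ∫ p in Ioo (-π) π ×ˢ Ioo (-π) π, Φ₁ (WithLp.toLp 2 ![p.1, p.2]) * Φ₂ (WithLp.toLp 2 ![p.1, p.2] - D) =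
      ∫ p in Ioo (-π) π ×ˢ Ioo (-π) π, Φ₂ (WithLp.toLp 2 ![p.1, p.2]) * Φ₁ (WithLp.toLp 2 ![p.1, p.2] + D) := by
  set F : ℝ × ℝ → ℂ := fun p => Φ₂ (WithLp.toLp 2 ![p.1, p.2]) * Φ₁ (WithLp.toLp 2 ![p.1, p.2] + D) with hFdef
  have hF : Continuous F := (hΦ₂.comp continuous_coordToLp).mul (hΦ₁.comp (continuous_coordToLp.add continuous_const))
  have h1 : ∀ x y, F (x + 2 * π, y) = F (x, y) := fun x y => by
    simp only [hFdef, toLp_pair_add_two_pi_fst, add_right_comm _ (EuclideanSpace.single (0 : Fin 2) (2 * π)) D, hp₁, hp₂]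
  have h2 : ∀ x y, F (x, y + 2 * π) = F (x, y) := fun x y => by
    simp only [hFdef, toLp_pair_add_two_pi_snd, add_right_comm _ (EuclideanSpace.single (1 : Fin 2) (2 * π)) D, hp₁, hp₂]
  have htr := setIntegral_zoneBox_comp_add hF h1 h2 (-(D 0, D 1))
  have hDF : ∀ p : ℝ × ℝ, F (p + -(D 0, D 1)) = Φ₁ (WithLp.toLp 2 ![p.1, p.2]) * Φ₂ (WithLp.toLp 2 ![p.1, p.2] - D) := fun p => by
    have hD : D = WithLp.toLp 2 ![D 0, D 1] := by ext i; fin_cases i <;> simp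
    have hc : (WithLp.toLp 2 ![(p + -(D 0, D 1)).1, (p + -(D 0, D 1)).2] : Momentum) = WithLp.toLp 2 ![p.1, p.2] - D := by
      rw [← sub_eq_add_neg, Prod.fst_sub, Prod.snd_sub, toLp_pair_sub, ← hD]
    simp only [hFdef, hc, sub_add_cancel, mul_comm]
  simp only [hDF] at htr
  exact htr

end Translate

/-! ## §2 The three-piece tube/far partition of the co-moving ph bubble -/

section Partition

/-- **THE THREE-PIECE PARTITION OF THE CO-MOVING ph BUBBLE** (any transfer momentum `D`): for continuous `χ, Ψ₁, Ψ₂`,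
`∫ Ψ₁(e_K q̂)Ψ₂(e_K(q̂−D)) = ∫ (χΨ₁)(e_K q̂)·Ψ₂(e_K(q̂−D)) + ∫ (χΨ₂)(e_K q̂)·((1−χ)Ψ₁)(e_K(q̂+D)) + ∫ ((1−χ)Ψ₁)(e_K q̂)·((1−χ)Ψ₂)(e_K(q̂−D))`
over the zone box — the middle piece TRANSLATED so that its tube variable is the partner's. -/
theorem zoneBox_bubble_ph_eq_three_pieces (μ : ℝ) (K : TrigPolyC4v) {χ Ψ₁ Ψ₂ : ℝ → ℂ} (hχ : Continuous χ) (hΨ₁ : Continuous Ψ₁)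
    (hΨ₂ : Continuous Ψ₂) (D : Momentum) :
    ∫ p in Ioo (-π) π ×ˢ Ioo (-π) π, Ψ₁ (frameLevel μ K (WithLp.toLp 2 ![p.1, p.2])) * Ψ₂ (frameLevel μ K (WithLp.toLp 2 ![p.1, p.2] - D)) =
      (∫ p in Ioo (-π) π ×ˢ Ioo (-π) π,
          χ (frameLevel μ K (WithLp.toLp 2 ![p.1, p.2])) * Ψ₁ (frameLevel μ K (WithLp.toLp 2 ![p.1, p.2])) *
            Ψ₂ (frameLevel μ K (WithLp.toLp 2 ![p.1, p.2] - D))) +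
      (∫ p in Ioo (-π) π ×ˢ Ioo (-π) π,
          χ (frameLevel μ K (WithLp.toLp 2 ![p.1, p.2])) * Ψ₂ (frameLevel μ K (WithLp.toLp 2 ![p.1, p.2])) *
            ((1 - χ (frameLevel μ K (WithLp.toLp 2 ![p.1, p.2] + D))) * Ψ₁ (frameLevel μ K (WithLp.toLp 2 ![p.1, p.2] + D)))) +
      ∫ p in Ioo (-π) π ×ˢ Ioo (-π) π,
          (1 - χ (frameLevel μ K (WithLp.toLp 2 ![p.1, p.2]))) * Ψ₁ (frameLevel μ K (WithLp.toLp 2 ![p.1, p.2])) *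
            ((1 - χ (frameLevel μ K (WithLp.toLp 2 ![p.1, p.2] - D))) * Ψ₂ (frameLevel μ K (WithLp.toLp 2 ![p.1, p.2] - D))) := by
  have he : Continuous (frameLevel μ K) := (EngineV8.contDiff_frameLevel μ K (n := 0)).continuous
  have hq : Continuous fun p : ℝ × ℝ => frameLevel μ K (WithLp.toLp 2 ![p.1, p.2]) := he.comp continuous_coordToLp
  have hDq : Continuous fun p : ℝ × ℝ => frameLevel μ K (WithLp.toLp 2 ![p.1, p.2] - D) := he.comp (continuous_coordToLp.sub continuous_const)
  have hI1 : IntegrableOn (fun p : ℝ × ℝ => χ (frameLevel μ K (WithLp.toLp 2 ![p.1, p.2])) * Ψ₁ (frameLevel μ K (WithLp.toLp 2 ![p.1, p.2])) *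
      Ψ₂ (frameLevel μ K (WithLp.toLp 2 ![p.1, p.2] - D))) (Ioo (-π) π ×ˢ Ioo (-π) π) :=
    integrableOn_zoneBox_of_continuous (((hχ.comp hq).mul (hΨ₁.comp hq)).mul (hΨ₂.comp hDq))
  have hI2 : IntegrableOn (fun p : ℝ × ℝ => (1 - χ (frameLevel μ K (WithLp.toLp 2 ![p.1, p.2]))) * Ψ₁ (frameLevel μ K (WithLp.toLp 2 ![p.1, p.2])) *
      (χ (frameLevel μ K (WithLp.toLp 2 ![p.1, p.2] - D)) * Ψ₂ (frameLevel μ K (WithLp.toLp 2 ![p.1, p.2] - D)))) (Ioo (-π) π ×ˢ Ioo (-π) π) :=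
    integrableOn_zoneBox_of_continuous ((((continuous_const.sub (hχ.comp hq)).mul (hΨ₁.comp hq))).mul ((hχ.comp hDq).mul (hΨ₂.comp hDq)))
  have hI3 : IntegrableOn (fun p : ℝ × ℝ => (1 - χ (frameLevel μ K (WithLp.toLp 2 ![p.1, p.2]))) * Ψ₁ (frameLevel μ K (WithLp.toLp 2 ![p.1, p.2])) *
      ((1 - χ (frameLevel μ K (WithLp.toLp 2 ![p.1, p.2] - D))) * Ψ₂ (frameLevel μ K (WithLp.toLp 2 ![p.1, p.2] - D)))) (Ioo (-π) π ×ˢ Ioo (-π) π) :=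
    integrableOn_zoneBox_of_continuous ((((continuous_const.sub (hχ.comp hq)).mul (hΨ₁.comp hq))).mul
      ((continuous_const.sub (hχ.comp hDq)).mul (hΨ₂.comp hDq)))
  have hI12 : IntegrableOn (fun p : ℝ × ℝ =>
      χ (frameLevel μ K (WithLp.toLp 2 ![p.1, p.2])) * Ψ₁ (frameLevel μ K (WithLp.toLp 2 ![p.1, p.2])) *
          Ψ₂ (frameLevel μ K (WithLp.toLp 2 ![p.1, p.2] - D)) +
        (1 - χ (frameLevel μ K (WithLp.toLp 2 ![p.1, p.2]))) * Ψ₁ (frameLevel μ K (WithLp.toLp 2 ![p.1, p.2])) *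
          (χ (frameLevel μ K (WithLp.toLp 2 ![p.1, p.2] - D)) * Ψ₂ (frameLevel μ K (WithLp.toLp 2 ![p.1, p.2] - D))))
      (Ioo (-π) π ×ˢ Ioo (-π) π) := hI1.add hI2
  have hsplit : ∫ p in Ioo (-π) π ×ˢ Ioo (-π) π, Ψ₁ (frameLevel μ K (WithLp.toLp 2 ![p.1, p.2])) * Ψ₂ (frameLevel μ K (WithLp.toLp 2 ![p.1, p.2] - D)) =
      (∫ p in Ioo (-π) π ×ˢ Ioo (-π) π,
          χ (frameLevel μ K (WithLp.toLp 2 ![p.1, p.2])) * Ψ₁ (frameLevel μ K (WithLp.toLp 2 ![p.1, p.2])) *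
            Ψ₂ (frameLevel μ K (WithLp.toLp 2 ![p.1, p.2] - D))) +
      (∫ p in Ioo (-π) π ×ˢ Ioo (-π) π,
          (1 - χ (frameLevel μ K (WithLp.toLp 2 ![p.1, p.2]))) * Ψ₁ (frameLevel μ K (WithLp.toLp 2 ![p.1, p.2])) *
            (χ (frameLevel μ K (WithLp.toLp 2 ![p.1, p.2] - D)) * Ψ₂ (frameLevel μ K (WithLp.toLp 2 ![p.1, p.2] - D)))) +
      ∫ p in Ioo (-π) π ×ˢ Ioo (-π) π,
          (1 - χ (frameLevel μ K (WithLp.toLp 2 ![p.1, p.2]))) * Ψ₁ (frameLevel μ K (WithLp.toLp 2 ![p.1, p.2])) *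
            ((1 - χ (frameLevel μ K (WithLp.toLp 2 ![p.1, p.2] - D))) * Ψ₂ (frameLevel μ K (WithLp.toLp 2 ![p.1, p.2] - D))) := by
    rw [← integral_add hI1 hI2, ← integral_add hI12 hI3]
    refine setIntegral_congr_fun (measurableSet_Ioo.prod measurableSet_Ioo) fun p _ => ?_
    exact bubble_integrand_partition χ Ψ₁ Ψ₂ _ _
  rw [hsplit]
  congr 2
  have hper : ∀ (g : ℝ → ℂ) (j : Fin 2) (q : Momentum), (fun q : Momentum => g (frameLevel μ K q)) (q + EuclideanSpace.single j (2 * π)) =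
      (fun q : Momentum => g (frameLevel μ K q)) q := fun g j q => by simp only [frameLevel_periodic_single]
  exact zoneBox_translate (Φ₁ := fun q : Momentum => (1 - χ (frameLevel μ K q)) * Ψ₁ (frameLevel μ K q))
    (Φ₂ := fun q : Momentum => χ (frameLevel μ K q) * Ψ₂ (frameLevel μ K q))
    ((continuous_const.sub (hχ.comp he)).mul (hΨ₁.comp he)) ((hχ.comp he).mul (hΨ₂.comp he))
    (hper (fun e => (1 - χ e) * Ψ₁ e)) (hper (fun e => χ e * Ψ₂ e)) D

/-- The same split over the lane's half-open zone box `[−π,π)²`. -/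
theorem zoneBoxIco_bubble_ph_eq_three_pieces (μ : ℝ) (K : TrigPolyC4v) {χ Ψ₁ Ψ₂ : ℝ → ℂ} (hχ : Continuous χ) (hΨ₁ : Continuous Ψ₁)
    (hΨ₂ : Continuous Ψ₂) (D : Momentum) :
    ∫ p in Ico (-π) π ×ˢ Ico (-π) π, Ψ₁ (frameLevel μ K (WithLp.toLp 2 ![p.1, p.2])) * Ψ₂ (frameLevel μ K (WithLp.toLp 2 ![p.1, p.2] - D)) =
      (∫ p in Ico (-π) π ×ˢ Ico (-π) π,
          χ (frameLevel μ K (WithLp.toLp 2 ![p.1, p.2])) * Ψ₁ (frameLevel μ K (WithLp.toLp 2 ![p.1, p.2])) *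
            Ψ₂ (frameLevel μ K (WithLp.toLp 2 ![p.1, p.2] - D))) +
      (∫ p in Ico (-π) π ×ˢ Ico (-π) π,
          χ (frameLevel μ K (WithLp.toLp 2 ![p.1, p.2])) * Ψ₂ (frameLevel μ K (WithLp.toLp 2 ![p.1, p.2])) *
            ((1 - χ (frameLevel μ K (WithLp.toLp 2 ![p.1, p.2] + D))) * Ψ₁ (frameLevel μ K (WithLp.toLp 2 ![p.1, p.2] + D)))) +
      ∫ p in Ico (-π) π ×ˢ Ico (-π) π,
          (1 - χ (frameLevel μ K (WithLp.toLp 2 ![p.1, p.2]))) * Ψ₁ (frameLevel μ K (WithLp.toLp 2 ![p.1, p.2])) *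
            ((1 - χ (frameLevel μ K (WithLp.toLp 2 ![p.1, p.2] - D))) * Ψ₂ (frameLevel μ K (WithLp.toLp 2 ![p.1, p.2] - D))) := by
  have hae : (Ico (-π) π ×ˢ Ico (-π) π : Set (ℝ × ℝ)) =ᵐ[volume] (Ioo (-π) π ×ˢ Ioo (-π) π : Set (ℝ × ℝ)) :=
    Measure.set_prod_ae_eq (Ioo_ae_eq_Ico (μ := volume) (a := -π) (b := π)).symm (Ioo_ae_eq_Ico (μ := volume) (a := -π) (b := π)).symm
  simp only [setIntegral_congr_set hae]
  exact zoneBox_bubble_ph_eq_three_pieces μ K hχ hΨ₁ hΨ₂ D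

end Partition

/-! ## §3 The far-far piece of the ph bubble at the co-moving transfer momentum -/

section Far

variable {a b : ℝ} (B : BandBounds a b) {K : TrigPolyC4v} {A : ℝ}
  (hA : ∀ p : Momentum, ∀ j ≤ 2, ‖iteratedFDeriv ℝ j (frameShift K) p‖ ≤ A) (hADt : 2 * A < B.Dtmin)
  {μ r : ℝ} (hlo : a < μ - r - A) (hhi : μ + r + A < b)
include B hA hADt hlo hhi

/-- The co-moving ph partner argument `θ ↦ H(e_K(q − (Φ(0,θ) − Φ(ρ′,ϑ′+θ))))` is `C^∞`. -/
theorem contDiff_farPartner_ph {H : ℝ → ℂ} (hH : ContDiff ℝ ∞ H) {ρ' : ℝ} (hρ' : |ρ'| < r) (ϑ' : ℝ) (q : Momentum) {n : ℕ∞} :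
    ContDiff ℝ n fun θ : ℝ => H (frameLevel μ K (q - (levelPoint μ K 0 θ - levelPoint μ K ρ' (ϑ' + θ)))) := by
  have h0 : |(0 : ℝ)| < r := by rw [abs_zero]; exact (abs_nonneg ρ').trans_lt hρ'
  have hl : ∀ {x : ℝ}, |x| < r → ContDiff ℝ n (levelPoint μ K x) := fun hx => contDiff_levelPoint_angle B hA hADt hlo hhi hx
  exact (hH.of_le (mod_cast le_top)).comp ((EngineV8.contDiff_frameLevel μ K).comp
    (contDiff_const.sub ((hl h0).sub ((hl hρ').comp (contDiff_const.add contDiff_id)))))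

/-- The far-far ph integrand `(q,θ) ↦ g(q̂)·H(e_K(q̂ − D(θ)))` is jointly `C^∞`. -/
theorem contDiff_farIntegrand_ph {g : Momentum → ℂ} (hg : ContDiff ℝ ∞ g) {H : ℝ → ℂ} (hH : ContDiff ℝ ∞ H) {ρ' : ℝ} (hρ' : |ρ'| < r)
    (ϑ' : ℝ) :
    ContDiff ℝ ∞ fun z : (ℝ × ℝ) × ℝ => g (WithLp.toLp 2 ![z.1.1, z.1.2]) *
      H (frameLevel μ K (WithLp.toLp 2 ![z.1.1, z.1.2] - (levelPoint μ K 0 z.2 - levelPoint μ K ρ' (ϑ' + z.2)))) := by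
  have h0 : |(0 : ℝ)| < r := by rw [abs_zero]; exact (abs_nonneg ρ').trans_lt hρ'
  have hl : ∀ {x : ℝ}, |x| < r → ContDiff ℝ ∞ (levelPoint μ K x) := fun hx => contDiff_levelPoint_angle B hA hADt hlo hhi hx
  have hc : ContDiff ℝ ∞ fun z : (ℝ × ℝ) × ℝ => (WithLp.toLp 2 ![z.1.1, z.1.2] : Momentum) := contDiff_toLp_pair.comp contDiff_fst
  have hD : ContDiff ℝ ∞ fun z : (ℝ × ℝ) × ℝ => levelPoint μ K 0 z.2 - levelPoint μ K ρ' (ϑ' + z.2) :=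
    ((hl h0).comp contDiff_snd).sub ((hl hρ').comp (contDiff_const.add contDiff_snd))
  exact (hg.comp hc).mul (hH.comp ((EngineV8.contDiff_frameLevel μ K).comp (hc.sub hD)))

/-- **EVERY BASE-ANGLE DERIVATIVE OF THE ph FAR-FAR PIECE** at `D(θ) = Φ(0,θ) − Φ(ρ′,ϑ′+θ)`:
`∂ᵏ_θ ∫ g(q̂)·H(e_K(q̂ − D(θ))) dq = ∫ g(q̂)·∂ᵏ_θ[H(e_K(q̂ − D(θ)))] dq`. -/
theorem iteratedDeriv_farIntegral_ph_eq {g : Momentum → ℂ} (hg : ContDiff ℝ ∞ g) {H : ℝ → ℂ} (hH : ContDiff ℝ ∞ H) {ρ' : ℝ} (hρ' : |ρ'| < r)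
    (ϑ' : ℝ) (k : ℕ) (θ : ℝ) :
    iteratedDeriv k (fun θ : ℝ => ∫ q in Ioo (-π) π ×ˢ Ioo (-π) π, g (WithLp.toLp 2 ![q.1, q.2]) *
        H (frameLevel μ K (WithLp.toLp 2 ![q.1, q.2] - (levelPoint μ K 0 θ - levelPoint μ K ρ' (ϑ' + θ))))) θ =
      ∫ q in Ioo (-π) π ×ˢ Ioo (-π) π, g (WithLp.toLp 2 ![q.1, q.2]) *
        iteratedDeriv k (fun θ : ℝ => H (frameLevel μ K (WithLp.toLp 2 ![q.1, q.2] - (levelPoint μ K 0 θ - levelPoint μ K ρ' (ϑ' + θ))))) θ := by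
  rw [iteratedDeriv_zoneBoxIntegral_eq (contDiff_farIntegrand_ph B hA hADt hlo hhi hg hH hρ' ϑ') k θ]
  refine setIntegral_congr_fun (measurableSet_Ioo.prod measurableSet_Ioo) fun q _ => ?_
  show iteratedDeriv k (fun θ : ℝ => g (WithLp.toLp 2 ![q.1, q.2]) *
      H (frameLevel μ K (WithLp.toLp 2 ![q.1, q.2] - (levelPoint μ K 0 θ - levelPoint μ K ρ' (ϑ' + θ))))) θ = _
  rw [iteratedDeriv_const_mul (g (WithLp.toLp 2 ![q.1, q.2]))
    ((contDiff_farPartner_ph B hA hADt hlo hhi hH hρ' ϑ' (WithLp.toLp 2 ![q.1, q.2]) (n := ⊤)).contDiffAt.of_le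
      (by exact_mod_cast (le_top : (k : ℕ∞) ≤ ⊤)))]

/-- The ph far-far piece is `C^∞` in the base angle. -/
theorem contDiff_farIntegral_ph {g : Momentum → ℂ} (hg : ContDiff ℝ ∞ g) {H : ℝ → ℂ} (hH : ContDiff ℝ ∞ H) {ρ' : ℝ} (hρ' : |ρ'| < r) (ϑ' : ℝ) :
    ContDiff ℝ ∞ fun θ : ℝ => ∫ q in Ioo (-π) π ×ˢ Ioo (-π) π, g (WithLp.toLp 2 ![q.1, q.2]) *
      H (frameLevel μ K (WithLp.toLp 2 ![q.1, q.2] - (levelPoint μ K 0 θ - levelPoint μ K ρ' (ϑ' + θ)))) :=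
  contDiff_zoneBoxIntegral (contDiff_farIntegrand_ph B hA hADt hlo hhi hg hH hρ' ϑ')

/-- Majorants pass under the ph far-far zone integral. -/
theorem norm_iteratedDeriv_farIntegral_ph_le {g : Momentum → ℂ} (hg : ContDiff ℝ ∞ g) {H : ℝ → ℂ} (hH : ContDiff ℝ ∞ H) {ρ' : ℝ} (hρ' : |ρ'| < r)
    (ϑ' : ℝ) (k : ℕ) (θ : ℝ) {m : ℝ × ℝ → ℝ} (hmi : IntegrableOn m (Ioo (-π) π ×ˢ Ioo (-π) π))
    (hm : ∀ q ∈ (Ioo (-π) π ×ˢ Ioo (-π) π : Set (ℝ × ℝ)), ‖iteratedDeriv k (fun θ : ℝ => g (WithLp.toLp 2 ![q.1, q.2]) *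
        H (frameLevel μ K (WithLp.toLp 2 ![q.1, q.2] - (levelPoint μ K 0 θ - levelPoint μ K ρ' (ϑ' + θ))))) θ‖ ≤ m q) :
    ‖iteratedDeriv k (fun θ : ℝ => ∫ q in Ioo (-π) π ×ˢ Ioo (-π) π, g (WithLp.toLp 2 ![q.1, q.2]) *
        H (frameLevel μ K (WithLp.toLp 2 ![q.1, q.2] - (levelPoint μ K 0 θ - levelPoint μ K ρ' (ϑ' + θ))))) θ‖ ≤
      ∫ q in Ioo (-π) π ×ˢ Ioo (-π) π, m q :=
  norm_iteratedDeriv_zoneBoxIntegral_le (contDiff_farIntegrand_ph B hA hADt hlo hhi hg hH hρ' ϑ') k θ hmi hm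

end Far

end Summit.HubbardSuperconductivity.HubbardSuperconductivity.Theorems.C4a

end
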